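import Literature.Probability.LatticeModels.FKObservableL2Bound
import Literature.Probability.LatticeModels.ObservableBulkGeometry
import Literature.Probability.LatticeModels.ScalingLimitCompactness
import Literature.Probability.LatticeModels.Sweep1Proofs
import HarnessLib

/-!
# The critical FK-Ising observable along a discretisation: continuum-scale bounds and subsequential limits

Topic `Literature/Probability/LatticeModels`; an instalment (item G2, continuum form, of the road
recorded in `Sweep1Proofs.lean`, module docstring §2b) of the discharge programme for
crit-ising.S18 / Smirnov's Theorem 2.2. Smirnov 2010, end of §5: "… the family of functions
`F_j/√δ_j` is precompact in the uniform topology on every compact subset of `Ω` … taking a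
subsequence we may assume that `F_j/√δ_j` converges uniformly on compacts". This file turns the
lattice bulk bounds of `FKObservableL2Bound.lean` into statements along a discretisation
`E : ℝ → DiscreteDobrushin` of a Dobrushin domain `D` (`IsDiscretisation`, as in the vendored
statement) as `δ → 0⁺`, and extracts the subsequential limits. Everything is proved.

* `obsAt E hE` (the observable for the canonical `Fintype` structure used by
  `fkObservableOfData`; `fkObservableOfData_eq_obsAt`, `medialVertexAt_eq_cSrc`); `ObsHyp E`
  (**the analytic hypotheses at one mesh**: admissibility, connected wired arc (H1), an FK
  primitive constant on the `A`- and `B`-sites cornering inner faces — Lemma 4.11 / the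
  hypotheses of `FKPrimitiveBounds`), with the lattice bulk bounds restated for it
  (`ObsHyp.norm_obsAt_le`, `norm_sub_obsAt_le`, `norm_vert_sub_horiz_le`).
* `norm_sub_le_of_steps`, `norm_sub_le_of_supNear` (lattice paths);
  `IsDiscretisation.exists_bulk_radius` (a metric radius `ρ(K) > 0` within which, eventually,
  all edges are interior; from `ObservableBulkGeometry.lean`).
* **`IsDiscretisation.exists_sqrt_bound`** (`‖F_δ‖ ≤ M √δ` at lattice points of a compact),
  **`exists_equicont_bound`** (`‖F_δ(x') - F_δ(x)‖ ≤ L √δ (|x' - x| + δ)`),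
  **`exists_cross_bound`** (vertical minus horizontal value `= O(δ√δ)`), all under
  `∀ᶠ δ, ObsHyp (E δ)`.
* **`IsDiscretisation.exists_subseq_limit`**: every sequence `δ_n → 0⁺` has a subsequence along
  which `δ^{-1/2} fkObservableOfData (E δ)` converges uniformly on every compact of `D` to a
  function continuous on `D` (`ScalingLimitCompactness.lean`).

## References

* S. Smirnov, Ann. of Math. 172 (2010) 1435–1467, Lemma 5.3 and §5 — bib key `Smirnov2010`.
-/

noncomputable section

namespace Literature.Probability.LatticeModels

open Filter _root_.Topology Metric Set Finset

/-! ### The observable of admissible data with its canonical finiteness structure -/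

namespace DiscreteDobrushin

/-- The canonical `Fintype` structure on the sites of admissible data (the one used by
`fkObservableOfData`). [cite: Smirnov2010, §2] -/
@[reducible] def admFintype (E : DiscreteDobrushin) (hE : E.IsZdAdmissible) : Fintype (meshDomain E.Ω E.δ) :=
  (meshDomain_finite hE.isBounded hE.delta_pos).fintype

end DiscreteDobrushin

/-- The critical FK-Ising observable of admissible data, for the canonical finiteness structure.
[cite: Smirnov2010, §2 (definition of F)] -/
def obsAt (E : DiscreteDobrushin) (hE : E.IsZdAdmissible) (z : MedialVertex) : ℂ :=
  @fkIsingObservable E (E.admFintype hE) criticalFKIsingParam z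

/-- `fkObservableOfData` is `obsAt` read at the medial vertex closest to `ζ`. [cite: Smirnov2010, §2] -/
theorem fkObservableOfData_eq_obsAt {E : DiscreteDobrushin} (hE : E.IsZdAdmissible) (ζ : ℂ) :
    fkObservableOfData E ζ = obsAt E hE (medialVertexAt E.δ ζ) := by
  unfold fkObservableOfData obsAt
  rw [dif_pos ⟨hE.isBounded, hE.delta_pos⟩]

/-- `medialVertexAt δ ζ` is the horizontal edge `cSrc (nearestSite δ ζ, 0)`. [folklore] -/
theorem medialVertexAt_eq_cSrc (δ : ℝ) (ζ : ℂ) : medialVertexAt δ ζ = cSrc (nearestSite δ ζ, 0) := rfl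

/-- **The analytic hypotheses on admissible Dobrushin data** used by the convergence programme:
admissibility, connectedness of the wired arc through edges of `Ω_δ` (hypothesis (H1) of
`isSHolomorphic_fkIsingObservable_of_zdArcA_connected`), and an FK primitive `(Hw, Hb)`
(`IsFKPrimitive`) constant on the `A`-sites and on the `B`-sites cornering inner faces (the
boundary values `H = 0` on `(ab)`, `H = 1` on `(ba)` of Lemma 4.11 / Remark 4.2). For
discretisations of Jordan domains these hold for all small meshes (arc-connectivity and
hole-freeness: `exists_isFKPrimitive`, `holeFree_innerFaces`); they are isolated as a predicate so
that the analysis does not depend on that combinatorics. [cite: Smirnov2010, Lemma 4.11 and §5] -/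
structure ObsHyp (E : DiscreteDobrushin) : Prop where
  adm : E.IsZdAdmissible
  arcA : ((discreteDomainGraph E.Ω E.δ).induce E.zdArcA).Preconnected
  prim : ∃ Hw Hb : Site 2 → ℝ, @IsFKPrimitive E (E.admFintype adm) adm Hw Hb ∧
    (∀ a' ∈ E.zdArcA, (∃ k, E.IsInnerFace (faceAt a' k)) → Hw a' = Hw (DiscreteDobrushin.startCorner adm).1) ∧
    (∀ b ∈ E.zdArcB, (∃ k, E.IsInnerFace (faceAt b k)) →
      Hw b = Hw ((DiscreteDobrushin.startCorner adm).1 + cornerUnit (DiscreteDobrushin.startCorner adm).2))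

namespace ObsHyp

variable {E : DiscreteDobrushin} (H : ObsHyp E)

/-- **Sup bound** (lattice form, canonical instance): `‖F(cSrc (x, i))‖ ≤ C/√p` on the ball of
radius `p` about the centre of a box of side `16p` all of whose nearby edges are interior.
[cite: Smirnov2010, Lemma 5.3 and §5] -/
theorem norm_obsAt_le {a : Site 2} {p : ℕ} (hp : 8 ≤ p)
    (hint : ∀ x ∈ latticeBall (boxCentre a (4 * p)) (2 * (2 * (4 * p)) + 2), ∀ k : Fin 4, E.IsInteriorEdge x k)
    {x : Site 2} (hx : x ∈ latticeBall (boxCentre a (4 * p)) p) {i : Fin 4} (hi : i = 0 ∨ i = 1) :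
    ‖obsAt E H.adm (cSrc (x, i))‖ ≤ obsSupConst / Real.sqrt p := by
  letI := E.admFintype H.adm
  obtain ⟨Hw, Hb, h, hcA, hcB⟩ := H.prim
  exact norm_fkIsingObservable_le_of_bulk h H.arcA hcA hcB hp hint hx hi

/-- **Lipschitz bound** (lattice form, canonical instance). [cite: Smirnov2010, §5] -/
theorem norm_sub_obsAt_le {a : Site 2} {q : ℕ} (hq : 8 ≤ q)
    (hint : ∀ x ∈ latticeBall (boxCentre a (4 * (2 * q))) (2 * (2 * (4 * (2 * q))) + 2), ∀ k : Fin 4, E.IsInteriorEdge x k)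
    {x : Site 2} (hx : x ∈ latticeBall (boxCentre a (4 * (2 * q))) q) {i : Fin 4} (hi : i = 0 ∨ i = 1) (j : Fin 4) :
    ‖obsAt E H.adm (cSrc (x + cornerUnit j, i)) - obsAt E H.adm (cSrc (x, i))‖ ≤
      8 * topGradConst * obsSupConst / ((2 * q : ℕ) * Real.sqrt (2 * q : ℕ)) := by
  letI := E.admFintype H.adm
  obtain ⟨Hw, Hb, h, hcA, hcB⟩ := H.prim
  exact norm_sub_fkIsingObservable_le_of_bulk h H.arcA hcA hcB hq hint hx hi j

/-- **The vertical values are close to the horizontal ones** (canonical instance): at a site whose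
edges `(x, 0)`, `(x, 1)`, `(x + e₁, 2)`, `(x + e₁, 3)` are interior,
`‖F(cSrc (x,1)) - F(cSrc (x,0))‖ ≤ ‖F(cSrc (x + e₁ + e₂, 0)) - F(cSrc (x, 0))‖`.
[cite: Smirnov2010, proof of Lemma 3.6] -/
theorem norm_vert_sub_horiz_le {x : Site 2} (h0 : E.IsInteriorEdge x 0) (h1 : E.IsInteriorEdge x 1)
    (h2 : E.IsInteriorEdge (x + cornerUnit 1) 2) (h3 : E.IsInteriorEdge (x + cornerUnit 1) 3) :
    ‖obsAt E H.adm (cSrc (x, 1)) - obsAt E H.adm (cSrc (x, 0))‖ ≤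
      ‖obsAt E H.adm (cSrc (x + cornerUnit 1 + cornerUnit 2, 0)) - obsAt E H.adm (cSrc (x, 0))‖ := by
  unfold obsAt
  letI := E.admFintype H.adm
  set c₀ := DiscreteDobrushin.startCorner H.adm
  have s0 : IsSHolAt (phasedObservable E H.adm) (x, 0) := isSHolAt_refPhase H.adm H.arcA h0 h1
  have s2 : IsSHolAt (phasedObservable E H.adm) (x + cornerUnit 1, 2) := isSHolAt_refPhase H.adm H.arcA h2 h3
  have key := norm_sub_le_of_isSHolAt s0 s2
  have e2 : cSrc (x + cornerUnit 1, (2 : Fin 4)) = cSrc (x + cornerUnit 1 + cornerUnit 2, 0) := by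
    rw [cSrc_two, show (2 : Fin 4) = 0 + 2 from rfl, cornerUnit_add_two, sub_eq_add_neg]
  rw [e2] at key
  simpa only [phasedObservable, ← mul_sub, norm_mul, norm_refPhase, one_mul] using key

end ObsHyp

/-! ### Lattice paths: from per-step bounds to differences -/

open DiscreteDobrushin in
/-- Telescoping along `t` steps in direction `k`. [folklore] -/
theorem norm_sub_le_of_steps (g : Site 2 → ℂ) (x : Site 2) (k : Fin 4) {Λ : ℝ} (t : ℕ)
    (h : ∀ s : ℕ, s < t → ‖g (x + ((s : ℤ) + 1) • cornerUnit k) - g (x + (s : ℤ) • cornerUnit k)‖ ≤ Λ) :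
    ‖g (x + (t : ℤ) • cornerUnit k) - g x‖ ≤ t * Λ := by
  induction t with
  | zero => simp
  | succ t ih =>
    have h1 := ih fun s hs => h s (Nat.lt_succ_of_lt hs)
    have h2 := h t (Nat.lt_succ_self t)
    push_cast at h2 ⊢
    calc ‖g (x + ((t : ℤ) + 1) • cornerUnit k) - g x‖
        ≤ ‖g (x + ((t : ℤ) + 1) • cornerUnit k) - g (x + (t : ℤ) • cornerUnit k)‖ + ‖g (x + (t : ℤ) • cornerUnit k) - g x‖ :=
          norm_sub_le_norm_sub_add_norm_sub _ _ _
      _ ≤ Λ + t * Λ := add_le_add h2 h1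
      _ = (t + 1) * Λ := by ring

open DiscreteDobrushin in
/-- **From per-step bounds on a sup-ball to differences**: if `‖g(y + e_j) - g(y)‖ ≤ Λ` for all
`y` within sup-distance `n` of `x` and all `j`, then `‖g x' - g x‖ ≤ 2 n Λ` for every `x'` within
sup-distance `n` of `x` (walk along the first axis, then the second). [folklore] -/
theorem norm_sub_le_of_supNear (g : Site 2 → ℂ) {x x' : Site 2} {n : ℕ} {Λ : ℝ} (hΛ : 0 ≤ Λ)
    (hx' : supNear x n x')
    (h : ∀ y : Site 2, supNear x n y → ∀ j : Fin 4, ‖g (y + cornerUnit j) - g y‖ ≤ Λ) :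
    ‖g x' - g x‖ ≤ 2 * n * Λ := by
  -- intermediate corner `xm = (x' 0, x 1)`
  set xm : Site 2 := ![x' 0, x 1] with hxm
  have h0 := hx' 0
  have h1 := hx' 1
  have hab0 := le_abs_self (x' 0 - x 0)
  have hab0' := neg_abs_le (x' 0 - x 0)
  have hab1 := le_abs_self (x' 1 - x 1)
  have hab1' := neg_abs_le (x' 1 - x 1)
  -- first leg: from `x` to `xm` along direction `0` or `2`
  have leg1 : ‖g xm - g x‖ ≤ n * Λ := by
    rcases le_or_gt 0 (x' 0 - x 0) with hpos | hneg
    · set t := (x' 0 - x 0).toNat with ht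
      have htz : (t : ℤ) = x' 0 - x 0 := Int.toNat_of_nonneg hpos
      have hxm' : xm = x + (t : ℤ) • cornerUnit 0 := by
        ext i; fin_cases i <;> simp [hxm, cornerUnit, htz]
      have htn : (t : ℝ) ≤ n := by
        have : (t : ℤ) ≤ n := by rw [htz]; exact (abs_le.1 h0).2
        exact_mod_cast this
      rw [hxm']
      refine (norm_sub_le_of_steps g x 0 t fun s hs => ?_).trans (mul_le_mul_of_nonneg_right htn hΛ)
      have := h (x + (s : ℤ) • cornerUnit 0) (fun i => by fin_cases i <;> simp [cornerUnit]; omega) 0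
      rwa [add_assoc, ← add_one_zsmul] at this
    · set t := (x 0 - x' 0).toNat with ht
      have htz : (t : ℤ) = x 0 - x' 0 := Int.toNat_of_nonneg (by omega)
      have hxm' : xm = x + (t : ℤ) • cornerUnit 2 := by
        ext i; fin_cases i <;> simp [hxm, cornerUnit, htz]
      have htn : (t : ℝ) ≤ n := by
        have : (t : ℤ) ≤ n := by rw [htz]; have := (abs_le.1 h0).1; omega
        exact_mod_cast this
      rw [hxm']
      refine (norm_sub_le_of_steps g x 2 t fun s hs => ?_).trans (mul_le_mul_of_nonneg_right htn hΛ)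
      have := h (x + (s : ℤ) • cornerUnit 2) (fun i => by fin_cases i <;> simp [cornerUnit]; omega) 2
      rwa [add_assoc, ← add_one_zsmul] at this
  -- second leg: from `xm` to `x'` along direction `1` or `3`
  have leg2 : ‖g x' - g xm‖ ≤ n * Λ := by
    have hxm0 : xm 0 = x' 0 := by simp [hxm]
    have hxm1 : xm 1 = x 1 := by simp [hxm]
    rcases le_or_gt 0 (x' 1 - x 1) with hpos | hneg
    · set t := (x' 1 - x 1).toNat with ht
      have htz : (t : ℤ) = x' 1 - x 1 := Int.toNat_of_nonneg hpos
      have hx'' : x' = xm + (t : ℤ) • cornerUnit 1 := by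
        ext i; fin_cases i <;> simp [hxm, cornerUnit, htz]
      have htn : (t : ℝ) ≤ n := by
        have : (t : ℤ) ≤ n := by rw [htz]; exact (abs_le.1 h1).2
        exact_mod_cast this
      rw [hx'']
      refine (norm_sub_le_of_steps g xm 1 t fun s hs => ?_).trans (mul_le_mul_of_nonneg_right htn hΛ)
      have hst : (s : ℤ) < t := by exact_mod_cast hs
      have := h (xm + (s : ℤ) • cornerUnit 1) (fun i => by fin_cases i <;> simp [hxm, cornerUnit] <;> omega) 1
      rwa [add_assoc, ← add_one_zsmul] at this
    · set t := (x 1 - x' 1).toNat with ht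
      have htz : (t : ℤ) = x 1 - x' 1 := Int.toNat_of_nonneg (by omega)
      have hx'' : x' = xm + (t : ℤ) • cornerUnit 3 := by
        ext i; fin_cases i <;> simp [hxm, cornerUnit, htz]
      have htn : (t : ℝ) ≤ n := by
        have : (t : ℤ) ≤ n := by rw [htz]; have := (abs_le.1 h1).1; omega
        exact_mod_cast this
      rw [hx'']
      refine (norm_sub_le_of_steps g xm 3 t fun s hs => ?_).trans (mul_le_mul_of_nonneg_right htn hΛ)
      have hst : (s : ℤ) < t := by exact_mod_cast hs
      have := h (xm + (s : ℤ) • cornerUnit 3) (fun i => by fin_cases i <;> simp [hxm, cornerUnit] <;> omega) 3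
      rwa [add_assoc, ← add_one_zsmul] at this
  calc ‖g x' - g x‖ ≤ ‖g x' - g xm‖ + ‖g xm - g x‖ := norm_sub_le_norm_sub_add_norm_sub _ _ _
    _ ≤ n * Λ + n * Λ := add_le_add leg2 leg1
    _ = 2 * n * Λ := by ring

/-! ### Sup-balls and lattice balls -/

open DiscreteDobrushin in
/-- `latticeBall x R` is the sup-ball of radius `R` about `x`. [folklore] -/
theorem mem_latticeBall_iff_supNear {x y : Site 2} {R : ℤ} : y ∈ latticeBall x R ↔ supNear x R y := by
  rw [mem_latticeBall]
  refine forall_congr' fun i => ?_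
  rw [abs_le]; constructor <;> intro h <;> constructor <;> linarith [h.1, h.2]

/-- The centre of the box with lower-left corner `x - (2m, 2m)` is `x`. [folklore] -/
theorem boxCentre_sub (x : Site 2) (m : ℕ) : boxCentre ![x 0 - 2 * m, x 1 - 2 * m] m = x := by
  ext i; fin_cases i <;> simp [boxCentre]

/-! ### The bulk radius of a compact, in the metric of the plane -/

section Continuum

variable {D : RandomPlanarGeometry.DobrushinDomain} {E : ℝ → DiscreteDobrushin}

open DiscreteDobrushin in
/-- **Metric bulk radius.** For a discretisation `E` of `D` and a compact `K ⊆ D` there is `ρ > 0`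
such that, for all small `δ > 0`, every edge at every site whose mesh point is within `ρ` of a mesh
point in `K` is an interior edge of `E δ` (variant of `IsDiscretisation.eventually_isInteriorEdge`
with a radius fixed in the plane rather than in the lattice). [cite: Smirnov2010, §5] -/
theorem IsDiscretisation.exists_bulk_radius (hDE : IsDiscretisation D E) {K : Set ℂ} (hK : IsCompact K)
    (hKD : K ⊆ D.carrier) :
    ∃ ρ > 0, ∀ᶠ δ in 𝓝[>] (0 : ℝ), ∀ x y : Site 2, meshPoint δ x ∈ K →
      dist (meshPoint δ y) (meshPoint δ x) ≤ ρ → ∀ k : Fin 4, (E δ).IsInteriorEdge y k := by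
  obtain ⟨r, hr, hrD⟩ := hK.exists_cthickening_subset_open D.isOpen hKD
  refine ⟨r / 4, by positivity, ?_⟩
  set K₁ := cthickening (r / 2) K with hK₁def
  have hK₁ : IsCompact K₁ := hK.cthickening
  have hK₁D : K₁ ⊆ D.carrier := (cthickening_mono (by linarith) K).trans hrD
  have h1 : ∀ᶠ δ in 𝓝[>] (0 : ℝ), ∀ z : Site 2, meshPoint δ z ∈ K₁ → z ∈ meshDomain D.carrier δ :=
    (RandomPlanarGeometry.JordanDomain.eventually_forall_mem_meshDomain' D.toJordanDomain hK₁ hK₁D).mono fun δ h => h.1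
  have hc : (0 : ℝ) < r / 24 := by positivity
  have h2 : ∀ᶠ δ in 𝓝[>] (0 : ℝ), δ < r / 24 := nhdsWithin_le_nhds (Iio_mem_nhds hc)
  have h3 : ∀ᶠ δ in 𝓝[>] (0 : ℝ), 0 < δ := self_mem_nhdsWithin
  filter_upwards [h1, h2, h3] with δ hδ1 hδ2 hδ3 x y hx hy k
  set T : Set (Site 2) := {z | meshPoint δ z ∈ K₁} with hT
  have hΩ : (E δ).Ω = D.carrier := hDE.Ω_eq δ
  have hδE : (E δ).δ = δ := hDE.δ_eq δ
  have hbulk : (E δ).IsBulkRegion T := by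
    refine ⟨fun z hz => ?_, fun v hv w hw hvw => ?_⟩
    · rw [hΩ, hδE]; exact hδ1 z hz
    · rw [hΩ, hδE, meshGraph_adj_iff]
      refine ⟨hvw, ?_⟩
      have hdw : dist (meshPoint δ w) (meshPoint δ v) ≤ 2 * δ := by
        have := dist_meshPoint_le_of_supNear hδ3.le (supNear_of_adj hvw)
        push_cast at this; linarith
      have h2δ : 0 ≤ 2 * δ := by linarith
      have hball : closedBall (meshPoint δ v) (2 * δ) ⊆ D.carrier := by
        intro p hp
        have hp' : p ∈ cthickening (2 * δ) K₁ :=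
          Metric.mem_cthickening_of_dist_le p (meshPoint δ v) (2 * δ) K₁ hv (mem_closedBall.1 hp)
        have : cthickening (2 * δ) K₁ ⊆ cthickening r K :=
          (cthickening_cthickening_subset h2δ (by positivity) K).trans (cthickening_mono (by linarith) K)
        exact hrD (this hp')
      refine ((convex_closedBall _ _).segment_subset (mem_closedBall_self h2δ) (mem_closedBall.2 hdw)).trans ?_
      exact hball.trans subset_closure
  refine hbulk.isInteriorEdge (fun z hz => ?_) k
  have hdz : dist (meshPoint δ z) (meshPoint δ y) ≤ 6 * δ := by
    have := dist_meshPoint_le_of_supNear hδ3.le hz; push_cast at this; linarith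
  have hdist : dist (meshPoint δ z) (meshPoint δ x) ≤ r / 2 :=
    calc dist (meshPoint δ z) (meshPoint δ x) ≤ dist (meshPoint δ z) (meshPoint δ y) + dist (meshPoint δ y) (meshPoint δ x) :=
          dist_triangle _ _ _
      _ ≤ 6 * δ + r / 4 := add_le_add hdz hy
      _ ≤ r / 2 := by linarith
  exact Metric.mem_cthickening_of_dist_le _ _ _ _ hx hdist

/-- Elementary: mesh distances in terms of lattice coordinates. [folklore] -/
theorem abs_sub_mul_le_dist_meshPoint (δ : ℝ) (x y : Site 2) (i : Fin 2) :
    |δ| * |((y i : ℤ) : ℝ) - x i| ≤ dist (meshPoint δ y) (meshPoint δ x) := by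
  rw [Complex.dist_eq]
  fin_cases i
  · have := Complex.abs_re_le_norm (meshPoint δ y - meshPoint δ x)
    simp only [Complex.sub_re, meshPoint_re] at this
    rwa [← mul_sub, abs_mul] at this
  · have := Complex.abs_im_le_norm (meshPoint δ y - meshPoint δ x)
    simp only [Complex.sub_im, meshPoint_im] at this
    rwa [← mul_sub, abs_mul] at this

/-! ### The `√δ`-bound on the observable over compacts -/

open DiscreteDobrushin in
/-- **`|F_δ| ≤ M √δ` on compacts.** For a discretisation with the analytic hypotheses eventually
in the mesh, on every compact `K ⊆ D` the observable at horizontal and vertical edges at sites with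
mesh point in `K` is `O(√δ)` — the continuum-scale form of the sup bound (Smirnov 2010, §5:
"`F_j/√δ_j` are uniformly bounded on compact subsets"). [cite: Smirnov2010, Lemma 5.3 and §5] -/
theorem IsDiscretisation.exists_sqrt_bound (hDE : IsDiscretisation D E) (hyp : ∀ᶠ δ in 𝓝[>] (0 : ℝ), ObsHyp (E δ))
    {K : Set ℂ} (hK : IsCompact K) (hKD : K ⊆ D.carrier) :
    ∃ M : ℝ, 0 ≤ M ∧ ∀ᶠ δ in 𝓝[>] (0 : ℝ), ∀ x : Site 2, meshPoint δ x ∈ K → ∀ i : Fin 4, (i = 0 ∨ i = 1) →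
      ∀ hE : (E δ).IsZdAdmissible, ‖obsAt (E δ) hE (cSrc (x, i))‖ ≤ M * Real.sqrt δ := by
  obtain ⟨ρ, hρ, hbulk⟩ := hDE.exists_bulk_radius hK hKD
  refine ⟨obsSupConst * Real.sqrt (128 / ρ), by have := obsSupConst_pos; positivity, ?_⟩
  have hc : (0 : ℝ) < ρ / 1000 := by positivity
  have h2 : ∀ᶠ δ in 𝓝[>] (0 : ℝ), δ < ρ / 1000 := nhdsWithin_le_nhds (Iio_mem_nhds hc)
  have h3 : ∀ᶠ δ in 𝓝[>] (0 : ℝ), 0 < δ := self_mem_nhdsWithin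
  filter_upwards [hyp, hbulk, h2, h3] with δ H hb hδs hδ0 x hx i hi hE
  -- the lattice scale `p ≈ ρ/(64 δ)`
  set p : ℕ := ⌊ρ / (64 * δ)⌋₊ with hpdef
  have hpr : (0 : ℝ) < ρ / (64 * δ) := by positivity
  have hple : (p : ℝ) ≤ ρ / (64 * δ) := Nat.floor_le hpr.le
  have hplt : ρ / (64 * δ) < p + 1 := Nat.lt_floor_add_one _
  have hbig : (15 : ℝ) ≤ ρ / (64 * δ) := by
    rw [le_div_iff₀ (by positivity)]; linarith
  have hp8 : 8 ≤ p := by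
    have : (8 : ℝ) ≤ p := by linarith
    exact_mod_cast this
  have hpge : ρ / (128 * δ) ≤ p := by
    have : ρ / (128 * δ) = ρ / (64 * δ) / 2 := by field_simp; ring
    rw [this]; linarith
  -- the box of side `16 p` centred at `x`
  set a : Site 2 := ![x 0 - 2 * (4 * p : ℕ), x 1 - 2 * (4 * p : ℕ)] with hadef
  have hca : boxCentre a (4 * p) = x := boxCentre_sub x (4 * p)
  have hint : ∀ y ∈ latticeBall (boxCentre a (4 * p)) (2 * (2 * (4 * p)) + 2), ∀ k : Fin 4, (E δ).IsInteriorEdge y k := by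
    intro y hy k
    rw [hca, mem_latticeBall_iff_supNear] at hy
    refine hb x y hx ?_ k
    have hd := dist_meshPoint_le_of_supNear hδ0.le hy
    push_cast at hd
    have : δ * (2 * (2 * (2 * (4 * (p : ℝ))) + 2)) ≤ ρ := by
      have h1 : δ * p ≤ ρ / 64 := by
        rw [le_div_iff₀ (by norm_num : (0:ℝ) < 64)]
        have := mul_le_mul_of_nonneg_left hple (by positivity : (0 : ℝ) ≤ 64 * δ)
        rw [mul_div_cancel₀ _ (by positivity)] at this
        linarith
      nlinarith
    exact hd.trans this
  have hxball : x ∈ latticeBall (boxCentre a (4 * p)) p := by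
    rw [hca, mem_latticeBall_iff_supNear]; exact supNear_self x (by positivity)
  have key := H.norm_obsAt_le hp8 hint hxball hi
  -- `obsSupConst / √p ≤ obsSupConst √(128/ρ) √δ`
  have hCpos := obsSupConst_pos
  have hsp : 0 < Real.sqrt p := Real.sqrt_pos.2 (by exact_mod_cast (show 0 < p by omega))
  calc ‖obsAt (E δ) hE (cSrc (x, i))‖ = ‖obsAt (E δ) H.adm (cSrc (x, i))‖ := rfl
    _ ≤ obsSupConst / Real.sqrt p := key
    _ ≤ obsSupConst / Real.sqrt (ρ / (128 * δ)) := by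
        gcongr
    _ = obsSupConst * Real.sqrt (128 / ρ) * Real.sqrt δ := by
        rw [mul_assoc, ← Real.sqrt_mul (by positivity), div_eq_mul_inv, ← Real.sqrt_inv]
        congr 2; field_simp

/-! ### Equicontinuity at scale `√δ` -/

open DiscreteDobrushin in
/-- **`|F_δ(x') - F_δ(x)| ≤ L √δ (|x' - x| + δ)` on compacts** (horizontal edges): the
continuum-scale form of the Lipschitz bound — the lattice form gives `O(δ^{3/2})` per lattice step
within distance `O(1)` (a path of `O(|x'-x|/δ)` steps), and distant pairs are handled by the
`√δ`-bound. [cite: Smirnov2010, §5 (equicontinuity of F_j/√δ_j)] -/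
theorem IsDiscretisation.exists_equicont_bound (hDE : IsDiscretisation D E) (hyp : ∀ᶠ δ in 𝓝[>] (0 : ℝ), ObsHyp (E δ))
    {K : Set ℂ} (hK : IsCompact K) (hKD : K ⊆ D.carrier) :
    ∃ L : ℝ, 0 ≤ L ∧ ∀ᶠ δ in 𝓝[>] (0 : ℝ), ∀ x x' : Site 2, meshPoint δ x ∈ K → meshPoint δ x' ∈ K →
      ∀ hE : (E δ).IsZdAdmissible, ‖obsAt (E δ) hE (cSrc (x', 0)) - obsAt (E δ) hE (cSrc (x, 0))‖ ≤
        L * Real.sqrt δ * (dist (meshPoint δ x') (meshPoint δ x) + δ) := by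
  obtain ⟨ρ, hρ, hbulk⟩ := hDE.exists_bulk_radius hK hKD
  obtain ⟨M, hM0, hM⟩ := hDE.exists_sqrt_bound hyp hK hKD
  set L₁ : ℝ := 16 * topGradConst * obsSupConst * (200 / ρ) * Real.sqrt (200 / ρ) with hL₁
  set L₂ : ℝ := 2 * M * (1000 / ρ) with hL₂
  have hK' := topGradConst_pos; have hC' := obsSupConst_pos
  have hL₁0 : 0 ≤ L₁ := by positivity
  have hL₂0 : 0 ≤ L₂ := by positivity
  refine ⟨max L₁ L₂, le_max_of_le_left hL₁0, ?_⟩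
  have hc : (0 : ℝ) < ρ / 2000 := by positivity
  have h2 : ∀ᶠ δ in 𝓝[>] (0 : ℝ), δ < ρ / 2000 := nhdsWithin_le_nhds (Iio_mem_nhds hc)
  have h3 : ∀ᶠ δ in 𝓝[>] (0 : ℝ), 0 < δ := self_mem_nhdsWithin
  filter_upwards [hyp, hbulk, hM, h2, h3] with δ H hb hMδ hδs hδ0 x x' hx hx' hE
  have hsq0 : 0 < Real.sqrt δ := Real.sqrt_pos.2 hδ0
  set dd := dist (meshPoint δ x') (meshPoint δ x) with hdd
  have hdd0 : 0 ≤ dd := dist_nonneg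
  by_cases hfar : ρ / 1000 < dd
  · -- distant points: both values are `O(√δ)`
    have b1 := hMδ x hx 0 (Or.inl rfl) hE
    have b2 := hMδ x' hx' 0 (Or.inl rfl) hE
    calc ‖obsAt (E δ) hE (cSrc (x', 0)) - obsAt (E δ) hE (cSrc (x, 0))‖
        ≤ ‖obsAt (E δ) hE (cSrc (x', 0))‖ + ‖obsAt (E δ) hE (cSrc (x, 0))‖ := norm_sub_le _ _
      _ ≤ 2 * M * Real.sqrt δ := by linarith
      _ ≤ L₂ * Real.sqrt δ * dd := by
          rw [hL₂]
          have : 1 ≤ (1000 / ρ) * dd := by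
            rw [div_mul_eq_mul_div, le_div_iff₀ hρ]; linarith
          calc 2 * M * Real.sqrt δ = 2 * M * Real.sqrt δ * 1 := (mul_one _).symm
            _ ≤ 2 * M * Real.sqrt δ * ((1000 / ρ) * dd) := by gcongr
            _ = 2 * M * (1000 / ρ) * Real.sqrt δ * dd := by ring
      _ ≤ max L₁ L₂ * Real.sqrt δ * (dd + δ) := by
          have : L₂ * Real.sqrt δ * dd ≤ max L₁ L₂ * Real.sqrt δ * dd := by gcongr; exact le_max_right _ _
          refine this.trans ?_
          have hm0 : 0 ≤ max L₁ L₂ * Real.sqrt δ := by positivity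
          nlinarith
  · -- nearby points: a lattice path of `O(dd/δ)` steps, each `O(δ^{3/2})`
    push Not at hfar
    -- the lattice scale `q ≈ ρ/(200 δ)`
    set q : ℕ := ⌊ρ / (200 * δ)⌋₊ with hqdef
    have hqr : (0 : ℝ) < ρ / (200 * δ) := by positivity
    have hqle : (q : ℝ) ≤ ρ / (200 * δ) := Nat.floor_le hqr.le
    have hqlt : ρ / (200 * δ) < q + 1 := Nat.lt_floor_add_one _
    have hbig : (10 : ℝ) ≤ ρ / (200 * δ) := by
      rw [le_div_iff₀ (by positivity)]; linarith
    have hq8 : 8 ≤ q := by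
      have : (8 : ℝ) ≤ q := by linarith
      exact_mod_cast this
    have hq0 : (0 : ℝ) < q := by exact_mod_cast (show 0 < q by omega)
    -- the box of side `32 q` centred at `x`
    set a : Site 2 := ![x 0 - 2 * (4 * (2 * q) : ℕ), x 1 - 2 * (4 * (2 * q) : ℕ)] with hadef
    have hca : boxCentre a (4 * (2 * q)) = x := boxCentre_sub x (4 * (2 * q))
    have hδq : δ * q ≤ ρ / 200 := by
      rw [le_div_iff₀ (by norm_num : (0:ℝ) < 200)]
      have := mul_le_mul_of_nonneg_left hqle (by positivity : (0 : ℝ) ≤ 200 * δ)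
      rw [mul_div_cancel₀ _ (by positivity)] at this
      linarith
    have hint : ∀ y ∈ latticeBall (boxCentre a (4 * (2 * q))) (2 * (2 * (4 * (2 * q))) + 2),
        ∀ k : Fin 4, (E δ).IsInteriorEdge y k := by
      intro y hy k
      rw [hca, mem_latticeBall_iff_supNear] at hy
      refine hb x y hx ?_ k
      have hd := dist_meshPoint_le_of_supNear hδ0.le hy
      push_cast at hd
      have : δ * (2 * (2 * (2 * (4 * (2 * (q : ℝ)))) + 2)) ≤ ρ := by nlinarith
      exact hd.trans this
    -- per-step bound on the sup-ball of radius `q` about `x`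
    set Λ : ℝ := 8 * topGradConst * obsSupConst / ((2 * q : ℕ) * Real.sqrt (2 * q : ℕ)) with hΛ
    have hΛ0 : 0 ≤ Λ := by rw [hΛ]; positivity
    have hstep : ∀ y : Site 2, supNear x q y → ∀ j : Fin 4,
        ‖obsAt (E δ) hE (cSrc (y + cornerUnit j, 0)) - obsAt (E δ) hE (cSrc (y, 0))‖ ≤ Λ := by
      intro y hy j
      have hyb : y ∈ latticeBall (boxCentre a (4 * (2 * q))) q := by
        rw [hca, mem_latticeBall_iff_supNear]; exact hy
      exact H.norm_sub_obsAt_le hq8 hint hyb (Or.inl rfl) j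
    -- the sup-distance `n` from `x` to `x'` is at most `dd/δ ≤ q`
    set n : ℕ := (max |x' 0 - x 0| |x' 1 - x 1|).toNat with hndef
    have hn0 : (0 : ℤ) ≤ max |x' 0 - x 0| |x' 1 - x 1| := le_max_of_le_left (abs_nonneg _)
    have hnz : (n : ℤ) = max |x' 0 - x 0| |x' 1 - x 1| := Int.toNat_of_nonneg hn0
    have hxn : supNear x n x' := by
      intro i; rw [hnz]
      fin_cases i
      · exact le_max_left _ _
      · exact le_max_right _ _
    have hnδ : (n : ℝ) * δ ≤ dd := by
      have e0 := abs_sub_mul_le_dist_meshPoint δ x x' 0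
      have e1 := abs_sub_mul_le_dist_meshPoint δ x x' 1
      rw [abs_of_pos hδ0] at e0 e1
      have hcast : (n : ℝ) = ((max |x' 0 - x 0| |x' 1 - x 1| : ℤ) : ℝ) := by exact_mod_cast hnz
      rw [hcast]
      rcases le_total |x' 0 - x 0| |x' 1 - x 1| with hle | hle
      · rw [max_eq_right hle]; push_cast; rw [mul_comm]; exact e1
      · rw [max_eq_left hle]; push_cast; rw [mul_comm]; exact e0
    have hnq : supNear x q x' := by
      refine supNear_mono hxn ?_
      have : (n : ℝ) ≤ q := by
        have h1 : (n : ℝ) * δ ≤ ρ / 1000 := hnδ.trans hfar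
        have h2 : ρ / 1000 ≤ δ * q := by
          have : ρ / (200 * δ) - 1 ≤ q := by linarith
          have h3 : δ * (ρ / (200 * δ) - 1) ≤ δ * q := mul_le_mul_of_nonneg_left this hδ0.le
          have h4 : δ * (ρ / (200 * δ) - 1) = ρ / 200 - δ := by field_simp
          linarith
        nlinarith
      exact_mod_cast this
    -- telescoping
    have hpath := norm_sub_le_of_supNear (fun y => obsAt (E δ) hE (cSrc (y, 0))) hΛ0 hxn
      (fun y hy j => hstep y (supNear_mono hy (by
        have : (n : ℝ) ≤ q := by
          have h1 : (n : ℝ) * δ ≤ ρ / 1000 := hnδ.trans hfar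
          have : ρ / (200 * δ) - 1 ≤ q := by linarith
          have h3 : δ * (ρ / (200 * δ) - 1) ≤ δ * q := mul_le_mul_of_nonneg_left this hδ0.le
          have h4 : δ * (ρ / (200 * δ) - 1) = ρ / 200 - δ := by field_simp
          nlinarith
        exact_mod_cast this)) j)
    -- `Λ ≤ 8 K C (200/ρ)^{3/2} δ^{3/2}` and `2 n Λ ≤ L₁ √δ dd`
    have h2q : ρ / (200 * δ) ≤ (2 * q : ℕ) := by
      push_cast; linarith
    have hΛle : Λ ≤ 8 * topGradConst * obsSupConst * ((200 / ρ) * Real.sqrt (200 / ρ)) * (δ * Real.sqrt δ) := by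
      rw [hΛ]
      have hX : 0 < ρ / (200 * δ) := hqr
      have h2q0 : (0 : ℝ) < (2 * q : ℕ) := by push_cast; linarith
      -- `1/((2q)√(2q)) ≤ (200δ/ρ)^{3/2}`
      have hinv : 1 / (((2 * q : ℕ) : ℝ) * Real.sqrt (2 * q : ℕ)) ≤ (200 * δ / ρ) * Real.sqrt (200 * δ / ρ) := by
        rw [div_le_iff₀ (by positivity)]
        have hs : Real.sqrt (ρ / (200 * δ)) ≤ Real.sqrt (2 * q : ℕ) := Real.sqrt_le_sqrt h2q
        have e1 : (200 * δ / ρ) * (ρ / (200 * δ)) = 1 := by field_simp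
        have e2 : Real.sqrt (200 * δ / ρ) * Real.sqrt (ρ / (200 * δ)) = 1 := by
          rw [← Real.sqrt_mul (by positivity), e1, Real.sqrt_one]
        calc (1 : ℝ) = ((200 * δ / ρ) * (ρ / (200 * δ))) * (Real.sqrt (200 * δ / ρ) * Real.sqrt (ρ / (200 * δ))) := by
              rw [e1, e2, one_mul]
          _ ≤ ((200 * δ / ρ) * (2 * q : ℕ)) * (Real.sqrt (200 * δ / ρ) * Real.sqrt (2 * q : ℕ)) := by
              gcongr
          _ = (200 * δ / ρ) * Real.sqrt (200 * δ / ρ) * (((2 * q : ℕ) : ℝ) * Real.sqrt (2 * q : ℕ)) := by ring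
      have e3 : (200 * δ / ρ) * Real.sqrt (200 * δ / ρ) = ((200 / ρ) * Real.sqrt (200 / ρ)) * (δ * Real.sqrt δ) := by
        rw [show 200 * δ / ρ = (200 / ρ) * δ by ring, Real.sqrt_mul (by positivity)]; ring
      calc 8 * topGradConst * obsSupConst / (((2 * q : ℕ) : ℝ) * Real.sqrt (2 * q : ℕ))
          = 8 * topGradConst * obsSupConst * (1 / (((2 * q : ℕ) : ℝ) * Real.sqrt (2 * q : ℕ))) := by ring
        _ ≤ 8 * topGradConst * obsSupConst * ((200 * δ / ρ) * Real.sqrt (200 * δ / ρ)) := by gcongr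
        _ = _ := by rw [e3]; ring
    calc ‖obsAt (E δ) hE (cSrc (x', 0)) - obsAt (E δ) hE (cSrc (x, 0))‖ ≤ 2 * n * Λ := hpath
      _ ≤ 2 * n * (8 * topGradConst * obsSupConst * ((200 / ρ) * Real.sqrt (200 / ρ)) * (δ * Real.sqrt δ)) := by gcongr
      _ = L₁ * Real.sqrt δ * (n * δ) := by rw [hL₁]; ring
      _ ≤ L₁ * Real.sqrt δ * dd := by gcongr
      _ ≤ max L₁ L₂ * Real.sqrt δ * (dd + δ) := by
          have : L₁ * Real.sqrt δ * dd ≤ max L₁ L₂ * Real.sqrt δ * dd := by gcongr; exact le_max_left _ _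
          refine this.trans ?_
          have hm0 : 0 ≤ max L₁ L₂ * Real.sqrt δ := by positivity
          nlinarith


/-! ### The vertical values: `|F(vertical) - F(horizontal)| = O(δ √δ)` -/

open DiscreteDobrushin in
/-- **The two sublattices merge in the limit**: on compacts, the value of the observable at the
vertical edge `(x, x + e₁)` differs from its value at the horizontal edge `(x, x + e₀)` by
`O(δ√δ) = o(√δ)`. [cite: Smirnov2010, §5] -/
theorem IsDiscretisation.exists_cross_bound (hDE : IsDiscretisation D E) (hyp : ∀ᶠ δ in 𝓝[>] (0 : ℝ), ObsHyp (E δ))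
    {K : Set ℂ} (hK : IsCompact K) (hKD : K ⊆ D.carrier) :
    ∃ L : ℝ, 0 ≤ L ∧ ∀ᶠ δ in 𝓝[>] (0 : ℝ), ∀ x : Site 2, meshPoint δ x ∈ K →
      ∀ hE : (E δ).IsZdAdmissible, ‖obsAt (E δ) hE (cSrc (x, 1)) - obsAt (E δ) hE (cSrc (x, 0))‖ ≤
        L * δ * Real.sqrt δ := by
  obtain ⟨ρ, hρ, hbulk⟩ := hDE.exists_bulk_radius hK hKD
  obtain ⟨L, hL0, hL⟩ := hDE.exists_equicont_bound hyp hK hKD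
  -- we use the equicontinuity bound between `x` and `x + e₁ + e₂` (both with mesh point near `K`):
  -- to stay inside `K` we rather redo the two-step estimate directly from the Lipschitz bound
  have hK' := topGradConst_pos; have hC' := obsSupConst_pos
  refine ⟨2 * (8 * topGradConst * obsSupConst * ((200 / ρ) * Real.sqrt (200 / ρ))), by positivity, ?_⟩
  have hc : (0 : ℝ) < ρ / 2000 := by positivity
  have h2 : ∀ᶠ δ in 𝓝[>] (0 : ℝ), δ < ρ / 2000 := nhdsWithin_le_nhds (Iio_mem_nhds hc)
  have h3 : ∀ᶠ δ in 𝓝[>] (0 : ℝ), 0 < δ := self_mem_nhdsWithin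
  filter_upwards [hyp, hbulk, h2, h3] with δ H hb hδs hδ0 x hx hE
  -- interior edges near `x`
  have hnear : ∀ y : Site 2, supNear x 3 y → ∀ k : Fin 4, (E δ).IsInteriorEdge y k := by
    intro y hy k
    refine hb x y hx ?_ k
    have hd := dist_meshPoint_le_of_supNear hδ0.le hy
    push_cast at hd; linarith
  have s1 : supNear x 3 (x + cornerUnit 1) := by intro i; fin_cases i <;> simp [cornerUnit]
  have key := H.norm_vert_sub_horiz_le (hnear x (supNear_self x (by norm_num)) 0) (hnear x (supNear_self x (by norm_num)) 1)
    (hnear _ s1 2) (hnear _ s1 3)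
  -- the Lipschitz scale `q`
  set q : ℕ := ⌊ρ / (200 * δ)⌋₊ with hqdef
  have hqr : (0 : ℝ) < ρ / (200 * δ) := by positivity
  have hqle : (q : ℝ) ≤ ρ / (200 * δ) := Nat.floor_le hqr.le
  have hqlt : ρ / (200 * δ) < q + 1 := Nat.lt_floor_add_one _
  have hbig : (10 : ℝ) ≤ ρ / (200 * δ) := by
    rw [le_div_iff₀ (by positivity)]; linarith
  have hq8 : 8 ≤ q := by
    have : (8 : ℝ) ≤ q := by linarith
    exact_mod_cast this
  set a : Site 2 := ![x 0 - 2 * (4 * (2 * q) : ℕ), x 1 - 2 * (4 * (2 * q) : ℕ)] with hadef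
  have hca : boxCentre a (4 * (2 * q)) = x := boxCentre_sub x (4 * (2 * q))
  have hδq : δ * q ≤ ρ / 200 := by
    rw [le_div_iff₀ (by norm_num : (0:ℝ) < 200)]
    have := mul_le_mul_of_nonneg_left hqle (by positivity : (0 : ℝ) ≤ 200 * δ)
    rw [mul_div_cancel₀ _ (by positivity)] at this
    linarith
  have hint : ∀ y ∈ latticeBall (boxCentre a (4 * (2 * q))) (2 * (2 * (4 * (2 * q))) + 2),
      ∀ k : Fin 4, (E δ).IsInteriorEdge y k := by
    intro y hy k
    rw [hca, mem_latticeBall_iff_supNear] at hy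
    refine hb x y hx ?_ k
    have hd := dist_meshPoint_le_of_supNear hδ0.le hy
    push_cast at hd
    have : δ * (2 * (2 * (2 * (4 * (2 * (q : ℝ)))) + 2)) ≤ ρ := by nlinarith
    exact hd.trans this
  set Λ : ℝ := 8 * topGradConst * obsSupConst / ((2 * q : ℕ) * Real.sqrt (2 * q : ℕ)) with hΛ
  have hΛ0 : 0 ≤ Λ := by rw [hΛ]; positivity
  have hstep : ∀ y : Site 2, supNear x 1 y → ∀ j : Fin 4,
      ‖obsAt (E δ) hE (cSrc (y + cornerUnit j, 0)) - obsAt (E δ) hE (cSrc (y, 0))‖ ≤ Λ := by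
    intro y hy j
    have hyb : y ∈ latticeBall (boxCentre a (4 * (2 * q))) q := by
      rw [hca, mem_latticeBall_iff_supNear]; exact supNear_mono hy (by exact_mod_cast (show 1 ≤ q by omega))
    exact H.norm_sub_obsAt_le hq8 hint hyb (Or.inl rfl) j
  have htwo : supNear x 1 (x + cornerUnit 1 + cornerUnit 2) := by intro i; fin_cases i <;> simp [cornerUnit]
  have hpath := norm_sub_le_of_supNear (fun y => obsAt (E δ) hE (cSrc (y, 0))) hΛ0 htwo
    (fun y hy j => hstep y hy j)
  simp only [Nat.cast_one] at hpath
  -- `Λ ≤ 8 K C (200/ρ)^{3/2} δ √δ`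
  have h2q : ρ / (200 * δ) ≤ (2 * q : ℕ) := by push_cast; linarith
  have hΛle : Λ ≤ 8 * topGradConst * obsSupConst * ((200 / ρ) * Real.sqrt (200 / ρ)) * (δ * Real.sqrt δ) := by
    rw [hΛ]
    have hinv : 1 / (((2 * q : ℕ) : ℝ) * Real.sqrt (2 * q : ℕ)) ≤ (200 * δ / ρ) * Real.sqrt (200 * δ / ρ) := by
      rw [div_le_iff₀ (by positivity)]
      have hs : Real.sqrt (ρ / (200 * δ)) ≤ Real.sqrt (2 * q : ℕ) := Real.sqrt_le_sqrt h2q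
      have e1 : (200 * δ / ρ) * (ρ / (200 * δ)) = 1 := by field_simp
      have e2 : Real.sqrt (200 * δ / ρ) * Real.sqrt (ρ / (200 * δ)) = 1 := by
        rw [← Real.sqrt_mul (by positivity), e1, Real.sqrt_one]
      calc (1 : ℝ) = ((200 * δ / ρ) * (ρ / (200 * δ))) * (Real.sqrt (200 * δ / ρ) * Real.sqrt (ρ / (200 * δ))) := by
            rw [e1, e2, one_mul]
        _ ≤ ((200 * δ / ρ) * (2 * q : ℕ)) * (Real.sqrt (200 * δ / ρ) * Real.sqrt (2 * q : ℕ)) := by gcongr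
        _ = (200 * δ / ρ) * Real.sqrt (200 * δ / ρ) * (((2 * q : ℕ) : ℝ) * Real.sqrt (2 * q : ℕ)) := by ring
    have e3 : (200 * δ / ρ) * Real.sqrt (200 * δ / ρ) = ((200 / ρ) * Real.sqrt (200 / ρ)) * (δ * Real.sqrt δ) := by
      rw [show 200 * δ / ρ = (200 / ρ) * δ by ring, Real.sqrt_mul (by positivity)]; ring
    calc 8 * topGradConst * obsSupConst / (((2 * q : ℕ) : ℝ) * Real.sqrt (2 * q : ℕ))
        = 8 * topGradConst * obsSupConst * (1 / (((2 * q : ℕ) : ℝ) * Real.sqrt (2 * q : ℕ))) := by ring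
      _ ≤ 8 * topGradConst * obsSupConst * ((200 * δ / ρ) * Real.sqrt (200 * δ / ρ)) := by gcongr
      _ = _ := by rw [e3]; ring
  calc ‖obsAt (E δ) hE (cSrc (x, 1)) - obsAt (E δ) hE (cSrc (x, 0))‖
      ≤ ‖obsAt (E δ) hE (cSrc (x + cornerUnit 1 + cornerUnit 2, 0)) - obsAt (E δ) hE (cSrc (x, 0))‖ := key
    _ ≤ 2 * 1 * Λ := hpath
    _ ≤ 2 * 1 * (8 * topGradConst * obsSupConst * ((200 / ρ) * Real.sqrt (200 / ρ)) * (δ * Real.sqrt δ)) := by gcongr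
    _ = _ := by ring

/-! ### Subsequential local uniform limits of `F_δ / √δ` -/

/-- **Precompactness of `F_δ/√δ` (Smirnov 2010, end of §5).** For a discretisation `E` of `D`
with the analytic hypotheses eventually in the mesh, every sequence `δ_n → 0⁺` has a subsequence
along which `δ^{-1/2} F_δ` (`F_δ = fkObservableOfData (E δ)`) converges uniformly on every compact
subset of `D` to a function continuous on `D`. [cite: Smirnov2010, §5 ("the family F_j/√δ_j is precompact")] -/
theorem IsDiscretisation.exists_subseq_limit (hDE : IsDiscretisation D E) (hyp : ∀ᶠ δ in 𝓝[>] (0 : ℝ), ObsHyp (E δ))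
    {s : ℕ → ℝ} (hs : Tendsto s atTop (𝓝[>] (0 : ℝ))) :
    ∃ φ : ℕ → ℕ, StrictMono φ ∧ ∃ g : ℂ → ℂ, ContinuousOn g D.carrier ∧
      ∀ K ⊆ D.carrier, IsCompact K → TendstoUniformlyOn
        (fun k z => ((Real.sqrt (s (φ k)))⁻¹ : ℂ) * fkObservableOfData (E (s (φ k))) z) g atTop K := by
  set u : ℕ → ℂ → ℂ := fun n z => ((Real.sqrt (s n))⁻¹ : ℂ) * fkObservableOfData (E (s n)) z with hu
  have hs0 : Tendsto s atTop (𝓝 (0 : ℝ)) := hs.mono_right nhdsWithin_le_nhds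
  have hspos : ∀ᶠ n in atTop, 0 < s n := hs.eventually (self_mem_nhdsWithin)
  refine exists_subseq_tendstoUniformlyOn_of_asympEquicontinuous D.isOpen u s hs0 ?_ ?_
  · -- boundedness on compacts
    intro K hKD hK
    obtain ⟨r, hr, hrD⟩ := hK.exists_cthickening_subset_open D.isOpen hKD
    have hK₁ : IsCompact (cthickening r K) := hK.cthickening
    obtain ⟨M, hM0, hM⟩ := hDE.exists_sqrt_bound hyp hK₁ hrD
    refine ⟨M, ?_⟩
    have hr' : ∀ᶠ δ in 𝓝[>] (0 : ℝ), δ ≤ r := nhdsWithin_le_nhds (Iic_mem_nhds hr)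
    have hall := hs.eventually ((hyp.and hM).and (hr'.and (self_mem_nhdsWithin : ∀ᶠ δ in 𝓝[>] (0:ℝ), 0 < δ)))
    refine hall.mono fun n hn z hz => ?_
    obtain ⟨⟨H, hMn⟩, hrn, hn0⟩ := hn
    have hδE : (E (s n)).δ = s n := hDE.δ_eq (s n)
    have hx : meshPoint (s n) (nearestSite (s n) z) ∈ cthickening r K :=
      Metric.mem_cthickening_of_dist_le _ z _ _ hz ((dist_meshPoint_nearestSite_le hn0 z).trans hrn)
    have key := hMn (nearestSite (s n) z) hx 0 (Or.inl rfl) H.adm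
    simp only [hu, fkObservableOfData_eq_obsAt H.adm, medialVertexAt_eq_cSrc, hδE, norm_mul, norm_inv,
      Complex.norm_real, Real.norm_eq_abs, abs_of_nonneg (Real.sqrt_nonneg _)]
    have hsq : 0 < Real.sqrt (s n) := Real.sqrt_pos.2 hn0
    rw [inv_mul_le_iff₀ hsq]
    linarith
  · -- asymptotic equicontinuity on compacts
    intro K hKD hK
    obtain ⟨r, hr, hrD⟩ := hK.exists_cthickening_subset_open D.isOpen hKD
    have hK₁ : IsCompact (cthickening r K) := hK.cthickening
    obtain ⟨L, hL0, hL⟩ := hDE.exists_equicont_bound hyp hK₁ hrD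
    refine ⟨3 * L, by positivity, ?_⟩
    have hr' : ∀ᶠ δ in 𝓝[>] (0 : ℝ), δ ≤ r := nhdsWithin_le_nhds (Iic_mem_nhds hr)
    have hall := hs.eventually ((hyp.and hL).and (hr'.and (self_mem_nhdsWithin : ∀ᶠ δ in 𝓝[>] (0:ℝ), 0 < δ)))
    refine hall.mono fun n hn z hz z' hz' => ?_
    obtain ⟨⟨H, hLn⟩, hrn, hn0⟩ := hn
    have hδE : (E (s n)).δ = s n := hDE.δ_eq (s n)
    set x := nearestSite (s n) z
    set x' := nearestSite (s n) z'
    have hx : meshPoint (s n) x ∈ cthickening r K :=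
      Metric.mem_cthickening_of_dist_le _ z _ _ hz ((dist_meshPoint_nearestSite_le hn0 z).trans hrn)
    have hx' : meshPoint (s n) x' ∈ cthickening r K :=
      Metric.mem_cthickening_of_dist_le _ z' _ _ hz' ((dist_meshPoint_nearestSite_le hn0 z').trans hrn)
    have key := hLn x' x hx' hx H.adm
    -- `dist (meshPoint x) (meshPoint x') ≤ ‖z - z'‖ + 2 δ`
    have hd : dist (meshPoint (s n) x) (meshPoint (s n) x') ≤ ‖z - z'‖ + 2 * s n := by
      calc dist (meshPoint (s n) x) (meshPoint (s n) x')
          ≤ dist (meshPoint (s n) x) z + dist z z' + dist z' (meshPoint (s n) x') := dist_triangle4 _ _ _ _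
        _ ≤ s n + ‖z - z'‖ + s n := by
            gcongr
            · exact dist_meshPoint_nearestSite_le hn0 z
            · exact (dist_eq_norm z z').le
            · rw [dist_comm]; exact dist_meshPoint_nearestSite_le hn0 z'
        _ = ‖z - z'‖ + 2 * s n := by ring
    simp only [hu, fkObservableOfData_eq_obsAt H.adm, medialVertexAt_eq_cSrc, hδE, ← mul_sub, norm_mul, norm_inv,
      Complex.norm_real, Real.norm_eq_abs, abs_of_nonneg (Real.sqrt_nonneg _)]
    have hsq : 0 < Real.sqrt (s n) := Real.sqrt_pos.2 hn0
    rw [inv_mul_le_iff₀ hsq]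
    calc ‖obsAt (E (s n)) H.adm (cSrc (x, 0)) - obsAt (E (s n)) H.adm (cSrc (x', 0))‖
        ≤ L * Real.sqrt (s n) * (dist (meshPoint (s n) x) (meshPoint (s n) x') + s n) := key
      _ ≤ L * Real.sqrt (s n) * ((‖z - z'‖ + 2 * s n) + s n) := by gcongr
      _ = Real.sqrt (s n) * (3 * L * ((‖z - z'‖ + 3 * s n) / 3)) := by ring
      _ ≤ Real.sqrt (s n) * (3 * L * (‖z - z'‖ + s n)) := by
          gcongr
          linarith [norm_nonneg (z - z')]

end Continuum

end Literature.Probability.LatticeModels
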